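import Summits.Ventures.PercRepro.SixFourPLProfile

/-!
# PercRepro — C-025 at `(6,4)`, §22.12.1 (iii): the coarse profile of a plane-line set, part B — the class
constraints, and `Constraints (profile D)` (p3, gen 9)

Continues `SixFourPLProfile.lean`: the class sizes of `profile D` satisfy the constraints of 22.12.5 —
every class has `s ≤ 7 − n` points (`Π_y ∩ G ⊇ λ_y ⊔ L`, at most `7` points), the skew sum rule `Σ s_j = p`
(the classes partition `ρ` when `ℓ` misses `ρ`) and the meeting sum rule `Σ (s_j − 1) = p − 1` (the sets
`λ_y ∖ {z}` partition `ρ ∖ {z}` when `ℓ ∩ ρ = {z}`), the lower bounds `s_j ≥ 1` / `≥ 2`, and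
`#{j : s_j = m} ≤ inc_m` (a class with `≥ 2` points is the trace of a line of `M`; distinct classes give distinct
lines).  **`constraints_profile`**: `Constraints (profile D)` for every normalisation of a plane-line set with
`10 ≤ g`, plane traces `≤ 7`; hence `profile D ∈ LIST` (`profile_mem_LIST`).
-/

namespace PercRepro.SixFour

open Finset ThmH

variable {α : Type*} [DecidableEq α] {M : Matroid α} [M.Finite] {G : Finset α}

namespace PLData

variable {D : PLData M G}

/-! ## The class sizes as a multiset -/

/-- Membership in `sizes`. -/
theorem mem_sizes {s : ℕ} : s ∈ D.sizes ↔ ∃ y ∈ D.ρ \ D.ellF, (D.lam y).card = s := by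
  unfold sizes classes
  rw [List.mem_reverse, Multiset.mem_sort, Multiset.mem_map]
  constructor
  · rintro ⟨C, hC, rfl⟩
    rw [Finset.mem_val, Finset.mem_image] at hC
    obtain ⟨y, hy, rfl⟩ := hC
    exact ⟨y, hy, rfl⟩
  · rintro ⟨y, hy, rfl⟩
    refine ⟨D.lam y, ?_, rfl⟩
    rw [Finset.mem_val, Finset.mem_image]
    exact ⟨y, hy, rfl⟩

/-- `Σ sizes = Σ_{C ∈ classes} |C|`. -/
theorem sizes_sum : D.sizes.sum = ∑ C ∈ D.classes, C.card := by
  unfold sizes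
  rw [List.sum_reverse, ← Multiset.sum_coe, Multiset.sort_eq, Finset.sum_eq_multiset_sum]

/-- `Σ (sizes − 1) = Σ_{C ∈ classes} (|C| − 1)`. -/
theorem sizes_sum_pred : (D.sizes.map fun s => s - 1).sum = ∑ C ∈ D.classes, (C.card - 1) := by
  unfold sizes
  rw [List.map_reverse, List.sum_reverse, ← Multiset.sum_coe, ← Multiset.map_coe, Multiset.sort_eq,
    Multiset.map_map, Finset.sum_eq_multiset_sum]
  rfl

/-- `count m sizes = #{C ∈ classes : |C| = m}`. -/
theorem sizes_count (m : ℕ) : D.sizes.count m = (D.classes.filter fun C => m = C.card).card := by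
  unfold sizes
  rw [List.count_reverse, ← Multiset.coe_count, Multiset.sort_eq, Multiset.count_map, Finset.card_def,
    Finset.filter_val]

/-! ## Each class has at most `7 − n` points -/

/-- `λ_y` and `L` are disjoint subsets of `Π_y ∩ G`. -/
theorem card_lam_add_card_L_le (hs : Simple M) (hG : G ⊆ gr M) (h2 : 2 ≤ D.L.card)
    (hpl : ∀ P ∈ planes M, (P ∩ G).card ≤ 7) {y : α} (hy : y ∈ D.ρ \ D.ellF) :
    (D.lam y).card + D.L.card ≤ 7 := by
  rw [Finset.mem_sdiff] at hy
  have hyG := D.ρ_subset hy.1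
  have hPi := Pi_mem_planes hs hG h2 hyG hy.2
  have hsub : D.lam y ∪ D.L ⊆ D.Pi y ∩ G := by
    intro z hz
    rw [Finset.mem_union] at hz
    rw [Finset.mem_inter]
    rcases hz with hz | hz
    · unfold lam at hz
      rw [Finset.mem_inter] at hz
      exact ⟨hz.1, D.ρ_subset hz.2⟩
    · exact ⟨hPi.2 (Finset.mem_insert_of_mem hz), D.L_subset hz⟩
  have hdisj : Disjoint (D.lam y) D.L := by
    rw [Finset.disjoint_left]
    intro z hz hzL
    unfold lam ρ at hz
    unfold L at hzL
    exact (Finset.mem_sdiff.1 hzL).2 (Finset.mem_inter.1 (Finset.mem_inter.1 hz).2).1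
  have := (Finset.card_le_card hsub).trans (hpl _ hPi.1)
  rw [Finset.card_union_of_disjoint hdisj] at this
  exact this

/-! ## The classes partition `ρ ∖ ℓ` -/

/-- Two distinct classes are disjoint outside `ℓ`: their intersection lies in `ℓ ∩ ρ`. -/
theorem classes_inter_subset (hs : Simple M) (hG : G ⊆ gr M) (h2 : 2 ≤ D.L.card) {C C' : Finset α}
    (hC : C ∈ D.classes) (hC' : C' ∈ D.classes) (hne : C ≠ C') : C ∩ C' ⊆ D.ellF ∩ D.ρ := by
  unfold classes at hC hC'
  rw [Finset.mem_image] at hC hC'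
  obtain ⟨y, hy, rfl⟩ := hC
  obtain ⟨y', hy', rfl⟩ := hC'
  rw [Finset.mem_sdiff] at hy hy'
  have hPi : D.Pi y ≠ D.Pi y' := by
    intro h
    apply hne
    unfold lam
    rw [h]
  intro z hz
  rw [Finset.mem_inter]
  refine ⟨lam_inter_subset_ellF hs hG h2 (D.ρ_subset hy.1) hy.2 (D.ρ_subset hy'.1) hy'.2 hPi hz, ?_⟩
  unfold lam at hz
  exact (Finset.mem_inter.1 (Finset.mem_inter.1 hz).1).2

/-- Every class is a subset of `ρ` containing a point outside `ℓ`. -/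
theorem classes_facts {C : Finset α} (hC : C ∈ D.classes) (hs : Simple M) (hG : G ⊆ gr M) (h2 : 2 ≤ D.L.card) :
    C ⊆ D.ρ ∧ ∃ y ∈ C, y ∉ D.ellF := by
  unfold classes at hC
  rw [Finset.mem_image] at hC
  obtain ⟨y, hy, rfl⟩ := hC
  rw [Finset.mem_sdiff] at hy
  exact ⟨fun z hz => (Finset.mem_inter.1 hz).2, y, mem_lam_self hs hG h2 hy.1 hy.2, hy.2⟩

/-- The classes, with `ℓ ∩ ρ` removed, partition `ρ ∖ ℓ`. -/
theorem biUnion_classes_sdiff (hs : Simple M) (hG : G ⊆ gr M) (h2 : 2 ≤ D.L.card) :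
    D.classes.biUnion (fun C => C \ D.ellF) = D.ρ \ D.ellF := by
  ext z
  rw [Finset.mem_biUnion]
  constructor
  · rintro ⟨C, hC, hz⟩
    rw [Finset.mem_sdiff] at hz ⊢
    exact ⟨(classes_facts hC hs hG h2).1 hz.1, hz.2⟩
  · intro hz
    refine ⟨D.lam z, ?_, ?_⟩
    · unfold classes
      exact Finset.mem_image.2 ⟨z, hz, rfl⟩
    · rw [Finset.mem_sdiff] at hz ⊢
      exact ⟨mem_lam_self hs hG h2 hz.1 hz.2, hz.2⟩

/-- The sets `C ∖ ℓ` over the classes are pairwise disjoint. -/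
theorem classes_pairwiseDisjoint (hs : Simple M) (hG : G ⊆ gr M) (h2 : 2 ≤ D.L.card) :
    (D.classes : Set (Finset α)).PairwiseDisjoint (fun C => C \ D.ellF) := by
  intro C hC C' hC' hne
  rw [Function.onFun, Finset.disjoint_left]
  intro z hz hz'
  rw [Finset.mem_sdiff] at hz hz'
  have := classes_inter_subset hs hG h2 hC hC' hne (Finset.mem_inter.2 ⟨hz.1, hz'.1⟩)
  exact hz.2 (Finset.mem_inter.1 this).1

/-- `Σ_{C ∈ classes} |C ∖ ℓ| = |ρ ∖ ℓ|`. -/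
theorem sum_card_classes_sdiff (hs : Simple M) (hG : G ⊆ gr M) (h2 : 2 ≤ D.L.card) :
    ∑ C ∈ D.classes, (C \ D.ellF).card = (D.ρ \ D.ellF).card := by
  rw [← Finset.card_biUnion (classes_pairwiseDisjoint hs hG h2), biUnion_classes_sdiff hs hG h2]

/-- `|C ∖ ℓ| = |C| − |ℓ ∩ ρ|` for a class `C` (`C ∩ ℓ = ℓ ∩ ρ` when `ℓ` meets `ρ`, since `z ∈ C`). -/
theorem card_class_sdiff (hs : Simple M) (hG : G ⊆ gr M) (h2 : 2 ≤ D.L.card) {C : Finset α}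
    (hC : C ∈ D.classes) : (C \ D.ellF).card = C.card - (D.ellF ∩ D.ρ).card := by
  have hCρ := (classes_facts hC hs hG h2).1
  have hCℓ : C ∩ D.ellF = D.ellF ∩ D.ρ := by
    apply Finset.Subset.antisymm
    · intro z hz
      rw [Finset.mem_inter] at hz ⊢
      exact ⟨hz.2, hCρ hz.1⟩
    · intro z hz
      rw [Finset.mem_inter] at hz ⊢
      unfold classes at hC
      rw [Finset.mem_image] at hC
      obtain ⟨y, -, rfl⟩ := hC
      exact ⟨mem_lam_of_mem_ellF hz.1 hz.2, hz.1⟩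
  rw [Finset.card_sdiff, Finset.inter_comm, hCℓ]

/-- **The sum rule**: `Σ_{C ∈ classes} |C| = |ρ| + (#classes − 1)·|ℓ ∩ ρ|` — skew: `Σ s_j = p`; meeting:
`Σ (s_j − 1) = p − 1`. -/
theorem sum_card_classes (hs : Simple M) (hG : G ⊆ gr M) (h2 : 2 ≤ D.L.card) :
    ∑ C ∈ D.classes, (C.card - (D.ellF ∩ D.ρ).card) = D.ρ.card - (D.ellF ∩ D.ρ).card := by
  rw [← Finset.sum_congr rfl (fun C hC => card_class_sdiff hs hG h2 hC), sum_card_classes_sdiff hs hG h2,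
    Finset.card_sdiff, Finset.inter_comm]

/-! ## The counts: a class with `≥ 2` points is the trace of a line -/

/-- A class with at least `2` points has rank `2`, and the line through it meets `ρ` exactly in it. -/
theorem class_line (hs : Simple M) (hG : G ⊆ gr M) (h2 : 2 ≤ D.L.card) {C : Finset α} (hC : C ∈ D.classes)
    (hc : 2 ≤ C.card) : clF M C ∈ lines M ∧ clF M C ∩ D.ρ = C := by
  have hCρ := (classes_facts hC hs hG h2).1
  have hCg : C ⊆ gr M := hCρ.trans (D.ρ_subset.trans hG)
  unfold classes at hC
  rw [Finset.mem_image] at hC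
  obtain ⟨y, hy, rfl⟩ := hC
  rw [Finset.mem_sdiff] at hy
  have hr2 : M.eRk ((D.lam y : Finset α) : Set α) = 2 := by
    obtain ⟨a, ha, b, hb, hab⟩ := Finset.one_lt_card.1 hc
    exact le_antisymm (eRk_lam_le_two hs hG h2 (D.ρ_subset hy.1) hy.2) (two_le_eRk_of_two_mem hs hCg ha hb hab)
  obtain ⟨hL, hsub⟩ := clF_mem_lines hCg hr2
  refine ⟨hL, Finset.Subset.antisymm ?_ (Finset.subset_inter hsub hCρ)⟩
  intro z hz
  rw [Finset.mem_inter] at hz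
  have hPi := Pi_mem_planes hs hG h2 (D.ρ_subset hy.1) hy.2
  have hcl : clF M (D.lam y) ⊆ D.Pi y := by
    unfold Pi
    rw [← Finset.coe_subset, coe_clF, coe_clF]
    calc M.closure ((D.lam y : Finset α) : Set α) ⊆ M.closure ((D.Pi y : Finset α) : Set α) :=
          M.closure_subset_closure (Finset.coe_subset.2 Finset.inter_subset_left)
      _ = M.closure ((insert y D.L : Finset α) : Set α) := by
          unfold Pi
          rw [coe_clF, M.closure_closure]
  unfold lam
  rw [Finset.mem_inter]
  exact ⟨hcl hz.1, hz.2⟩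

/-- **The count constraint**: `#{C ∈ classes : |C| = m} ≤ inc_m` for `m ≥ 2` (`C ↦ cl(C)` is injective into the
lines with trace `m` on `ρ`). -/
theorem card_classes_le_inc (hs : Simple M) (hG : G ⊆ gr M) (h2 : 2 ≤ D.L.card) {m : ℕ} (hm : 2 ≤ m) :
    (D.classes.filter fun C => m = C.card).card ≤ inc M D.ρ m := by
  unfold inc
  refine Finset.card_le_card_of_injOn (fun C => clF M C) ?_ ?_
  · intro C hC
    rw [Finset.mem_coe, Finset.mem_filter] at hC
    obtain ⟨hL, htr⟩ := class_line hs hG h2 hC.1 (by omega)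
    rw [Finset.mem_coe, Finset.mem_filter, htr]
    exact ⟨hL, hC.2.symm⟩
  · intro C hC C' hC' heq
    rw [Finset.mem_coe, Finset.mem_filter] at hC hC'
    simp only at heq
    rw [← (class_line hs hG h2 hC.1 (by omega)).2, ← (class_line hs hG h2 hC'.1 (by omega)).2, heq]

/-! ## The constraints -/

/-- Every class has at least one point outside `ℓ`, and `z ∈ ℓ ∩ ρ` when the line meets `ρ`. -/
theorem one_le_card_class {C : Finset α} (hC : C ∈ D.classes) (hs : Simple M) (hG : G ⊆ gr M)
    (h2 : 2 ≤ D.L.card) : (D.ellF ∩ D.ρ).card + 1 ≤ C.card := by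
  obtain ⟨hCρ, y, hyC, hyℓ⟩ := classes_facts hC hs hG h2
  have hsub : insert y (D.ellF ∩ D.ρ) ⊆ C := by
    intro z hz
    rw [Finset.mem_insert] at hz
    rcases hz with rfl | hz
    · exact hyC
    · rw [Finset.mem_inter] at hz
      unfold classes at hC
      rw [Finset.mem_image] at hC
      obtain ⟨y', -, rfl⟩ := hC
      exact mem_lam_of_mem_ellF hz.1 hz.2
  have hnot : y ∉ D.ellF ∩ D.ρ := fun h => hyℓ (Finset.mem_inter.1 h).1
  have := Finset.card_le_card hsub
  rw [Finset.card_insert_of_notMem hnot] at this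
  omega

/-- **`Constraints (profile D)`** for every normalisation of a plane-line set of a simple matroid with `g ≥ 10`
and plane traces `≤ 7`. -/
theorem constraints_profile (hs : Simple M) (hG : G ⊆ gr M) (hpl : ∀ P ∈ planes M, (P ∩ G).card ≤ 7)
    (hg : 10 ≤ G.card) : PL.Constraints D.profile := by
  obtain ⟨hne, hp4, hp7, hn3, hg13⟩ := size_facts (D := D) hs hG hpl hg
  have h2 : 2 ≤ D.L.card := by omega
  have he := e_profile_eq (D := D) hs hG h2
  have hcardℓ := D.card_ellF_inter_le_one hs hG h2
  have hℓρ : (D.ellF ∩ D.ρ).card ≤ 1 :=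
    (Finset.card_le_card (Finset.inter_subset_inter (Finset.Subset.refl _) Finset.inter_subset_left)).trans hcardℓ
  have hsum := D.card_ρ_add_card_L
  have hp : D.profile.p = D.ρ.card := rfl
  have hn : D.profile.n = D.L.card := rfl
  unfold PL.Constraints
  rw [hp, hn, he]
  refine ⟨hp4, hp7, hn3, hne, by omega, by omega, by simp [profile], ?_, ?_, sizes_pairwise, ?_, ?_, ?_⟩
  · intro i hi hp
    exact inc_profile_eq_zero i hi hp
  · exact pair_identity_profile hs hG hp7
  · intro s hs'
    obtain ⟨y, hy, rfl⟩ := mem_sizes.1 hs'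
    have := card_lam_add_card_L_le hs hG h2 hpl hy
    show (D.lam y).card ≤ 7 - D.L.card
    omega
  · -- the case split on `meet`
    have hmeet : D.profile.meet = decide ((D.ellF ∩ D.ρ).card = 1) := rfl
    have hsizes : D.profile.sizes = D.sizes := rfl
    rw [hmeet, hsizes]
    have key := sum_card_classes hs hG h2
    by_cases h1 : (D.ellF ∩ D.ρ).card = 1
    · rw [if_pos (by simpa using h1)]
      rw [h1] at key
      refine ⟨fun s hs' => ?_, ?_⟩
      · obtain ⟨y, hy, rfl⟩ := mem_sizes.1 hs'
        have := one_le_card_class (Finset.mem_image.2 ⟨y, hy, rfl⟩) hs hG h2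
        rw [h1] at this
        exact this
      · rw [sizes_sum_pred, key]
    · rw [if_neg (by simpa using h1)]
      have h0 : (D.ellF ∩ D.ρ).card = 0 := by omega
      rw [h0] at key
      simp only [Nat.sub_zero] at key
      refine ⟨fun s hs' => ?_, ?_⟩
      · obtain ⟨y, hy, rfl⟩ := mem_sizes.1 hs'
        have := one_le_card_class (Finset.mem_image.2 ⟨y, hy, rfl⟩) hs hG h2
        rw [h0] at this
        exact this
      · rw [sizes_sum, key]
  · intro m hm2 hm7
    have hsizes : D.profile.sizes = D.sizes := rfl
    rw [hsizes, sizes_count, inc_profile (m - 2) (by omega), show m - 2 + 2 = m by omega]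
    exact card_classes_le_inc hs hG h2 hm2

/-- **Profile completeness (22.12.5 (i))**: the coarse profile of every normalised plane-line set is in `LIST`. -/
theorem profile_mem_LIST (hs : Simple M) (hG : G ⊆ gr M) (hpl : ∀ P ∈ planes M, (P ∩ G).card ≤ 7)
    (hg : 10 ≤ G.card) : D.profile ∈ PL.LIST :=
  PL.mem_LIST_of_constraints (constraints_profile hs hG hpl hg)

end PLData

end PercRepro.SixFour
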